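import Summits.CriticalPhenomena.Ising3DConformalLimit.Theses.FKParityRobustness
import Summits.CriticalPhenomena.Ising3DConformalLimit.Theorems.FKParityRobustnessDefs
import Literature.Probability.LatticeModels.UrsellFourCurrents
import Literature.Probability.LatticeModels.LoopO1

/-!
# Sketch — crux `Target` (stmt-CriticalPhenomena-11252), crux-ideate round 1, ideator 3

First lemmas of the two idea cards `aizenman-product-rung` and `spectator-copy-robustness`
(route `FKParityRobustness`), stated over existing declarations.  Nothing here is asserted as an
axiom: crux-level statements are `def … : Prop`, provable-now lemmas are `def … : Prop` marked
(L), and the glue of the repaired route is an honest `theorem` (`closes_of_productRung`).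

Dictionary (all in tree): `Current G`, `Current.traced`, `tracedConn G x z`,
`doubleCurrentMeasure G β A B = P^A ⊗ P^B`, `ursellFour_eq_doubleCurrent G` (Aizenman's identity,
`UrsellFourCurrents.lean`); `tJoins G ω A`, `evenSubgraphs G ω`, `loopO1Measure G t A = ℓ^A_{G,t}`
(`LoopO1.lean`); `JoinsAll`, `boxGraph N`, `tc = tanh β_c(3)`, `tetra`
(`Theorems/FKParityRobustnessDefs.lean`); the route decls `Theses.FKParityRobustness.FarMergingGivesU4`,
`.MoebiusLimit`.
-/

noncomputable section

open MeasureTheory Finset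
open scoped symmDiff
open Literature.Probability.LatticeModels
open Summit.CriticalPhenomena.Ising3DConformalLimit.Cruxes.ParityRobustMerging.PlaquetteXorSurgery
  (JoinsAll boxGraph tc tetra tetra_inj)

namespace Summit.CriticalPhenomena.Ising3DConformalLimit.Cruxes.Target.SketchK3

open scoped Classical

section General

variable {V : Type*} [Fintype V] [DecidableEq V] (G : SimpleGraph V) [DecidableRel G.Adj]

/-! ## Card 1 — `aizenman-product-rung` -/

/-- The odd part (high-temperature graph) `odd(n) = {e ∈ E(G) : n_e odd}` of a current. Under the
single-current law `P^A` its law is the sourced loop-O(1) measure `ℓ^A_{G, tanh β}` (expand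
`∑ βⁿ/n!` over parities: `cosh` on even, `sinh` on odd edges). -/
def oddPart (n : Current G) : Finset (Sym2 V) :=
  (Finset.univ.filter fun e : ↥G.edgeFinset => Odd (n e)).image Subtype.val

/-- Vertex set of the STRAND `K_ω(x)`: the component of `x` in the spanning subgraph `(V, ω)`. -/
def strandVerts (ω : Set (Sym2 V)) (x : V) : Set V :=
  {v | (SimpleGraph.fromEdgeSet ω).Reachable x v}

/-- The PRODUCT-RUNG event: the odd strands of the two INDEPENDENT currents share a vertex —
`K_{odd n₁}(x) ∩ K_{odd n₂}(z) ≠ ∅`. -/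
def oddStrandsMeet (x z : V) : Set (Current G × Current G) :=
  {p | ∃ v, v ∈ strandVerts (↑(oddPart G p.1) : Set (Sym2 V)) x ∧
            v ∈ strandVerts (↑(oddPart G p.2) : Set (Sym2 V)) z}

/-- (L1, provable now, pure combinatorics) odd strands that share a vertex are traced-connected:
`odd(nᵢ) ⊆ traced(nᵢ) ⊆ traced(n₁ + n₂)`, so a common vertex `v` gives `x ⟷ v ⟷ z`. -/
def OddStrandsMeetSubset : Prop :=
  ∀ x z : V, oddStrandsMeet G x z ⊆ tracedConn G x z

/-- (L2, provable now from the vendored fact `ursellFour_eq_doubleCurrent` + L1 + monotonicity of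
measure) the PRODUCT-RUNG PARITY BOUND, Aizenman's identity read with its ORIGINAL two 2-source
currents: `U₄(a) ≤ −2 ⟨σ_{a0}σ_{a1}⟩⟨σ_{a2}σ_{a3}⟩ · P^{a0a1} ⊗ P^{a2a3}[odd strands meet]`.
No switching lemma, no four-source `T`-joins, no FK measure. -/
def ProductRungBound : Prop :=
  ∀ {β : ℝ}, 0 ≤ β → ursellFour_eq_doubleCurrent G → ∀ a : Fin 4 → V,
    connectedFour (isingMeasure G univ β 0 .free) spinAt ![a 0, a 1, a 2, a 3] ≤
      -(2 * isingTwoPoint G univ β 0 .free (a 0) (a 1) * isingTwoPoint G univ β 0 .free (a 2) (a 3) *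
        (doubleCurrentMeasure G β ({a 0} ∆ {a 1}) ({a 2} ∆ {a 3})).real (oddStrandsMeet G (a 0) (a 2)))

/-- (L3, provable now: dictionary) the law of the pair of odd parts under `P^A ⊗ P^B` is the
product of sourced loop-O(1) measures `ℓ^A_{tanh β} ⊗ ℓ^B_{tanh β}` — in particular the two strands
of the product rung are INDEPENDENT (this is where dimensions add: `2·D_HT > 3`). -/
def OddPartsLaw : Prop :=
  ∀ {β : ℝ}, 0 ≤ β → ∀ A B : Finset V, currentSum G β A ≠ 0 → currentSum G β B ≠ 0 →
    Measure.map (fun p : Current G × Current G =>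
        ((↑(oddPart G p.1) : Set (Sym2 V)), (↑(oddPart G p.2) : Set (Sym2 V))))
      (doubleCurrentMeasure G β A B) =
    (loopO1Measure G (Real.tanh β) A).prod (loopO1Measure G (Real.tanh β) B)

/-- (L4, provable now; the one RIGOROUS handle spin correlations have on strand geometry, used in
the card's provability analysis) THERMAL LOWER BOUND ON THE STRAND DENSITY: for the two-source
measure `ℓ^{xy}_t`, `t = tanh β`, and an edge `zw` of `G` away from the sources,
`ℓ^{xy}[zw ∈ E(K(x))] ≥ t/(1-t²) · (⟨σ_xσ_yσ_zσ_w⟩/⟨σ_xσ_y⟩ − ⟨σ_zσ_w⟩)` (free b.c., zero field).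
Proof sketch: toggling the edge `zw` is a bijection `𝒯_{xyzw} ↔ 𝒯_{xy}`, giving
`ℓ^{xy}[zw ∈ F] = t(⟨σ_xσ_yσ_zσ_w⟩/⟨σ_xσ_y⟩ − t)/(1−t²)`; conditionally on the strand `K = K_F(x)`
the rest `F ∖ E(K)` is `ℓ^∅` on `G − V(K)` (exact Markov property), whose edge density is
`t(⟨σ_zσ_w⟩_{G−V(K)} − t)/(1−t²) ≤ t(⟨σ_zσ_w⟩_G − t)/(1−t²)` by Griffiths II. Exponent content:
the right side scales with `Δ_ε = 1.41`, the left with `x₂ = 1.265` — lossy by `l^{-0.15}`. -/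
def StrandDensityThermal : Prop :=
  ∀ {β : ℝ}, 0 ≤ β → ∀ x y z w : V, x ≠ y → G.Reachable x y → G.Adj z w →
    z ≠ x → z ≠ y → w ≠ x → w ≠ y →
      Real.tanh β / (1 - Real.tanh β ^ 2) *
          (isingCorr G univ β 0 .free {x, y, z, w} / isingTwoPoint G univ β 0 .free x y -
            isingTwoPoint G univ β 0 .free z w) ≤
        (loopO1Measure G (Real.tanh β) {x, y}).real
          {F | s(z, w) ∈ F ∧ z ∈ strandVerts F x}

/-! ## Card 2 — `spectator-copy-robustness` -/

/-- SPECTATOR ROBUSTNESS `w_a(ω, ω′) ∈ [0,1]`: the fraction of pairs `(F, F′)` — `F` a `T`-join of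
`A = {aᵢ}` inside `ω`, `F′` an even subgraph of the INDEPENDENT configuration `ω′` — such that all
four sources lie in one component of `F ∪ F′` (`0/0 = 0`).  Compare the crux's `u_a(ω)`, which is
the case `F′ = ∅`: `w ≥` nothing and `≤ 1[𝓕_A]`, but `w_a(ω, ω′) ≥ u_a(ω)` pointwise. -/
def spectatorRobustness (a : Fin 4 → V) (ω ω' : Set (Sym2 V)) : ℝ :=
  ((((tJoins G ω (univ.image a)) ×ˢ (evenSubgraphs G ω')).filter
        (fun q => JoinsAll a (q.1 ∪ q.2))).card : ℝ) /
    (((tJoins G ω (univ.image a)).card : ℝ) * ((evenSubgraphs G ω').card : ℝ))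

/-- (L5, provable now) `u ≤ w`: the spectator can only help. So every lower bound the route proves for
`∫ u dφ` transfers, and `ParityBound′` below is at least as sharp as `ParityBound`. -/
def SpectatorDominatesParity : Prop :=
  ∀ (a : Fin 4 → V) (ω ω' : Set (Sym2 V)),
    ((((tJoins G ω (univ.image a)).filter (fun F => JoinsAll a F)).card : ℝ) /
        ((tJoins G ω (univ.image a)).card : ℝ)) ≤ spectatorRobustness G a ω ω'

/-- (L6, provable now: switching lemma → `P^A ⊗ P^∅` → odd parts `(F, F′) ~ ℓ^A ⊗ ℓ^∅` (L3) →
sourced Grimmett–Janson on `ω` and plain Grimmett–Janson (Grimmett Thm 8.66) on `ω′`)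
`ParityBound′`: `U₄(a) ≤ −2 · E_{φ⊗φ}[w_a]` on every finite graph — the route's ParityBound with the
sourceless partner current of the switching lemma KEPT as an independent spectator instead of being
discarded (`odd(n₁) ∪ odd(n₂) ⊆ traced(n₁+n₂)`). -/
def ParityBoundSpectator : Prop :=
  ∀ {β : ℝ}, 0 ≤ β → ∀ a : Fin 4 → V, Function.Injective a →
    connectedFour (isingMeasure G univ β 0 .free) spinAt a ≤
      -(2 * ∫ q, spectatorRobustness G a q.1 q.2
          ∂((rcMeasure G (fkIsingParam β) 2 ∅).prod (rcMeasure G (fkIsingParam β) 2 ∅)))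

/-- (L7, provable now: the two Grimmett–Janson pushforwards, fibrewise) SPECTATOR TRANSFER:
`E_{φ⊗φ}[w_a] = ⟨σ_A⟩ · (ℓ^A ⊗ ℓ^∅)[A joined in F ∪ F′]`, written multiplicatively. -/
def SpectatorTransfer : Prop :=
  ∀ {β : ℝ}, 0 ≤ β → ∀ a : Fin 4 → V, Function.Injective a →
    ∫ q, spectatorRobustness G a q.1 q.2
        ∂((rcMeasure G (fkIsingParam β) 2 ∅).prod (rcMeasure G (fkIsingParam β) 2 ∅)) =
      isingCorr G univ β 0 .free (univ.image a) *
        ((loopO1Measure G (Real.tanh β) (univ.image a)).prod (loopO1Measure G (Real.tanh β) ∅)).real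
          {q | ∀ i j, (SimpleGraph.fromEdgeSet (q.1 ∪ q.2)).Reachable (a i) (a j)}

end General

/-! ## Crux-level statements on the box (the repaired conjuncts) -/

/-- Card 1, crux-level (ITM, "independent trails meet"; replaces BLOB ∧ P4): two INDEPENDENT critical
high-temperature source strands of the free box, one from `a₀` to `a₁`, one from `a₂` to `a₃`
(tetrahedron `l • tetra`), share a vertex with probability `≥ c` uniformly in `l`
(`N ≥ N₀(l)`).  Predicted TRUE: `2·D_HT − 3 = 0.47 > 0`; `= 1` for boundary points in `d = 2`
(DC2016 Cor. 4.5); fails exactly for `d ≥ 4` (`D_HT = 2`). -/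
def IndependentTrailsMeet : Prop :=
  ∃ c : ℝ, 0 < c ∧ ∀ l : ℕ, 1 ≤ l → ∃ N₀ : ℕ, ∀ N : ℕ, N₀ ≤ N → ∀ a : Fin 4 → ↥(box 3 N),
    (∀ i, ((a i : Site 3)) = (l : ℤ) • tetra i) →
      c ≤ ((loopO1Measure (boxGraph N) tc {a 0, a 1}).prod (loopO1Measure (boxGraph N) tc {a 2, a 3})).real
            {q | ∃ v, v ∈ strandVerts q.1 (a 0) ∧ v ∈ strandVerts q.2 (a 2)}

/-- Card 2, crux-level (BLOB′, "spectator-robust merging"; replaces BLOB, keeps P4): conditionally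
on the four critical FK arms merging, a parity-respecting fair halving of the cluster TOGETHER WITH
a fair halving of an independent critical FK configuration ties the four points together with
probability `≥ c`. -/
def SpectatorRobustMerging : Prop :=
  ∃ c : ℝ, 0 < c ∧ ∀ l : ℕ, 1 ≤ l → ∃ N₀ : ℕ, ∀ N : ℕ, N₀ ≤ N → ∀ a : Fin 4 → ↥(box 3 N),
    (∀ i, ((a i : Site 3)) = (l : ℤ) • tetra i) →
      (let φ := rcMeasure (boxGraph N) (fkIsingParam (criticalBeta 3)) 2 ∅;
       c * φ.real {ω | ∀ i j, (Literature.Probability.Percolation.openGraph ω).Reachable (a i) (a j)} ≤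
         ∫ q, spectatorRobustness (boxGraph N) a q.1 q.2 ∂(φ.prod φ))

/-- Card 2 in loop dress (the single quantity the MC job j012608 measures as `P_spect`):
`(ℓ^A ⊗ ℓ^∅)[A joined in F ∪ F′] ≥ c` uniformly in `l`. Equivalent to
`SpectatorRobustMerging ∧ FKFourConnectivity` up to constants (SpectatorTransfer + Lebowitz +
Griffiths II), exactly as `SourceTrailsMeet ⟺ BLOB ∧ P4`. -/
def SpectatorTrailsJoin : Prop :=
  ∃ c : ℝ, 0 < c ∧ ∀ l : ℕ, 1 ≤ l → ∃ N₀ : ℕ, ∀ N : ℕ, N₀ ≤ N → ∀ a : Fin 4 → ↥(box 3 N),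
    (∀ i, ((a i : Site 3)) = (l : ℤ) • tetra i) →
      c ≤ ((loopO1Measure (boxGraph N) tc (univ.image a)).prod (loopO1Measure (boxGraph N) tc ∅)).real
            {q | ∀ i j, (SimpleGraph.fromEdgeSet (q.1 ∪ q.2)).Reachable (a i) (a j)}

/-! ## The lattice bound both cards feed, and the certified glue of the repaired route -/

/-- The tetrahedral far-merging bound `U₄^crit(l • tetra) ≤ −c ⟨σσ⟩⟨σσ⟩` at one scale `L`
(verbatim the inner inequality of `Theses.FKParityRobustness.FarMergingGivesU4` at `x := tetra`). -/
def tetraU4Bound (c : ℝ) (L : ℕ) : Prop :=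
  criticalCorr 3 4 (fun i => (L : ℤ) • tetra i) -
      (criticalCorr 3 2 ![(L : ℤ) • tetra 0, (L : ℤ) • tetra 1] * criticalCorr 3 2 ![(L : ℤ) • tetra 2, (L : ℤ) • tetra 3] +
        criticalCorr 3 2 ![(L : ℤ) • tetra 0, (L : ℤ) • tetra 2] * criticalCorr 3 2 ![(L : ℤ) • tetra 1, (L : ℤ) • tetra 3] +
        criticalCorr 3 2 ![(L : ℤ) • tetra 0, (L : ℤ) • tetra 3] * criticalCorr 3 2 ![(L : ℤ) • tetra 1, (L : ℤ) • tetra 2]) ≤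
    -(c * (criticalCorr 3 2 ![(L : ℤ) • tetra 0, (L : ℤ) • tetra 1] * criticalCorr 3 2 ![(L : ℤ) • tetra 2, (L : ℤ) • tetra 3]))

/-- The lattice bound at every scale (the conclusion of the route's `LatticeBoundFromFK`). -/
def TetraLatticeBound : Prop :=
  ∃ c : ℝ, 0 < c ∧ ∀ l : ℕ, 1 ≤ l → tetraU4Bound c l

/-- (L8, provable now, same proof as the route's `LatticeBoundFromFK` minus the FK steps)
`ITM ⇒ lattice bound`: ProductRungBound on the box graph `Λ_N`, OddPartsLaw to pass to
`ℓ^{01} ⊗ ℓ^{23}`, ITM, then `N → ∞` by `criticalCorr_wellDefined` (free box limits = critical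
state, in tree). -/
def LatticeBoundFromITM : Prop :=
  IndependentTrailsMeet → TetraLatticeBound

/-- (L9, provable now) `BLOB′ ∧ P4 ⇒ lattice bound`, via ParityBoundSpectator (the route's
`LatticeBoundFromFK` with `u ↦ w`). -/
def LatticeBoundFromSpectator : Prop :=
  SpectatorRobustMerging → Theses.FKParityRobustness.FKFourConnectivity → TetraLatticeBound

/-- CERTIFIED GLUE of the repaired route (either card): the lattice bound at the tetrahedron, the
route's provable-now support `FarMergingGivesU4` (stmt-4471) and the imported complement
`MoebiusLimit` (stmt-1344) decide the sub-problem.  Pure logic. -/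
theorem closes_of_latticeBound (hT : TetraLatticeBound)
    (hFar : Theses.FKParityRobustness.FarMergingGivesU4) (hML : Theses.FKParityRobustness.MoebiusLimit) :
    _root_.Ising3DConformalLimit := by
  obtain ⟨c, hc, hl⟩ := hT
  have hfar := hFar ⟨c, hc, tetra, tetra_inj, fun L₀ => ⟨max L₀ 1, le_max_left _ _,
    hl (max L₀ 1) (le_max_right _ _)⟩⟩
  obtain ⟨ρ, Δ, S, hρ, hΔ, hlim, hnd, hmob⟩ := hML
  exact ⟨ρ, Δ, S, hρ, hΔ, hlim, hnd, hmob, hfar ρ S hρ hlim hnd⟩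

/-- The repaired deciding theorem for card 1: `ITM`, `LatticeBoundFromITM` (provable now),
`FarMergingGivesU4` (provable now), `MoebiusLimit` (imported crux). -/
theorem closes_of_productRung (h₁ : IndependentTrailsMeet) (h₂ : LatticeBoundFromITM)
    (h₃ : Theses.FKParityRobustness.FarMergingGivesU4) (h₄ : Theses.FKParityRobustness.MoebiusLimit) :
    _root_.Ising3DConformalLimit :=
  closes_of_latticeBound (h₂ h₁) h₃ h₄

/-- The repaired deciding theorem for card 2: `BLOB′`, `P4`, `LatticeBoundFromSpectator`
(provable now), `FarMergingGivesU4`, `MoebiusLimit`. -/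
theorem closes_of_spectator (h₁ : SpectatorRobustMerging) (h₂ : Theses.FKParityRobustness.FKFourConnectivity)
    (h₃ : LatticeBoundFromSpectator) (h₄ : Theses.FKParityRobustness.FarMergingGivesU4)
    (h₅ : Theses.FKParityRobustness.MoebiusLimit) : _root_.Ising3DConformalLimit :=
  closes_of_latticeBound (h₃ h₁ h₂) h₄ h₅

end Summit.CriticalPhenomena.Ising3DConformalLimit.Cruxes.Target.SketchK3

end
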